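import Literature.AlgebraicGeometry.HodgeTheory.AlgebraicityLocusBoundary
import HarnessLib

/-!
# The algebraicity locus from complete witnesses with the generic dichotomy (assembly step)

Topic `Literature/AlgebraicGeometry/HodgeTheory` (family `hodge`), fifth proof file towards the
named fact `charlesSchnell_algebraicityLocus_iUnion_closed` (`AlgebraicityLocus.lean`), after
`AlgebraicityLocusParametrised` (glue: proper parameter spaces with closed good sets),
`SupportedLocusClosed` (strong closedness of good sets; Zariski-closure upgrade),
`AlgebraicityLocusCurves` (limits of supported classes along curves) and
`AlgebraicityLocusBoundary` (algebraicity at all complex points of an irreducible parameter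
variety good over a dense open part, granted Mumford's curve lemma).

This file assembles the ARCHITECTURE of the printed proof (Charles–Schnell, *Notes on absolute
Hodge classes*, proof of Prop. 11.3.11; Voisin, *Hodge Theory II*, §3.3.1 and proof of Thm. 7.19:
"the algebraicity locus is the union of the images of those components of the relative Hilbert
scheme which parametrise the class; they are proper over `S` and countable in number") on the
tree's carriers, where `algebraicClasses` is support-defined and the components of the Hilbert
scheme are replaced by irreducible closed subsets of arbitrary proper parameter spaces of
SUPPORTS:

* `exists_finite_isIrreducible_cover_of_dichotomy` — Noetherian induction: if every irreducible
  closed subset of a Noetherian space has a non-empty relatively open part over which a property of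
  "points over it" holds either everywhere or nowhere, then finitely many irreducible closed
  subsets, each good over a non-empty relatively open part, carry all good points;
* `algebraicityLocus_eq_iUnion_of_dichotomy` — for a smooth projective family `f : 𝒳 ⟶ S` over a
  smooth quasi-projective base, a class `A ∈ H²ᵖ(𝒳(ℂ); ℂ)` and countably many proper parameter
  `S`-schemes `H_i` with closed families of supports `𝒵_i ⊆ 𝒳 × H_i` and good sets
  `Good_i ⊆ H_i(ℂ)` (good points have slices of codimension `≥ p` off which `A` dies) which are
  COMPLETE (every algebraic `A|_{𝒳_t}` is witnessed by a good point over `t`) and satisfy the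
  GENERIC DICHOTOMY (every irreducible closed `Y ⊆ H_i` is generically good or generically bad),
  the algebraicity locus of `A` is `⋃_j W_j(ℂ)` for countably many Zariski-closed `W_j ⊆ S` —
  granted Mumford's lemma (`hM : Motives.mumford_smoothCurve_through_two_points`, an existing
  named fact of the tree, used by the boundary step).

What is NOT here (the two remaining inputs of the named fact on this route): a complete countable
family of witnesses (tuples of hypersurface sections of the fibres: every Zariski-closed subset of
a fibre is cut out by finitely many forms of one degree) and the generic dichotomy for it (generic
local constancy of the span of the classes of the codimension-`p` components of the slices over an
irreducible parameter variety: EGA IV₃ 9.7.8 with the strong closedness of `SupportedLocusClosed`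
and the rationality of supported classes).

## References

* [CharlesSchnell2014Notes] F. Charles, C. Schnell, Notes on absolute Hodge classes, in Hodge
  Theory (Princeton Math. Notes 49, 2014), Prop. 11.3.11 (proof).
* [VoisinHodgeII2003] C. Voisin, Hodge Theory and Complex Algebraic Geometry II (2003), §3.3.1,
  §7.3.2 (proof of Thm. 7.19).
* [Hartshorne1977] R. Hartshorne, Algebraic Geometry (1977), I Prop. 1.5 (Noetherian induction,
  irreducible components), II Ex. 3.17.
-/

noncomputable section

open CategoryTheory AlgebraicGeometry Limits Set Order MonoidalCategory CartesianMonoidalCategory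
open _root_.Topology TopologicalSpace
open Literature.AlgebraicGeometry.Motives

universe u v

namespace Literature.AlgebraicGeometry.HodgeTheory

section HodgeTheory

/-! ### Noetherian induction: finitely many good irreducible closed sets carry the good points -/

/-- An irreducible component of a Noetherian topological space contains a non-empty open subset of
the space (the complement of the union of the other components). [folklore] -/
theorem exists_isOpen_nonempty_subset_of_mem_irreducibleComponents {α : Type u}
    [TopologicalSpace α] [NoetherianSpace α] {Z : Set α} (hZ : Z ∈ irreducibleComponents α) :
    ∃ V : Set α, IsOpen V ∧ V.Nonempty ∧ V ⊆ Z := by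
  have hfin := NoetherianSpace.finite_irreducibleComponents (α := α)
  set V : Set α := (⋃₀ (irreducibleComponents α \ {Z}))ᶜ with hV
  have hVo : IsOpen V := by
    rw [hV, Set.sUnion_eq_biUnion, isOpen_compl_iff]
    exact hfin.sdiff.isClosed_biUnion fun W hW => isClosed_of_mem_irreducibleComponents W hW.1
  have hVZ : V ⊆ Z := by
    intro v hv
    by_contra hvZ
    obtain ⟨W, hW, hvW⟩ := Set.mem_sUnion.1
      ((sUnion_irreducibleComponents (X := α)).symm ▸ mem_univ v : v ∈ ⋃₀ irreducibleComponents α)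
    exact hv (Set.mem_sUnion.2 ⟨W, ⟨hW, fun h => hvZ (h ▸ hvW)⟩, hvW⟩)
  have hVne : V.Nonempty := by
    by_contra hVe
    rw [not_nonempty_iff_eq_empty] at hVe
    have h := closure_sUnion_irreducibleComponents_sdiff_singleton hfin Z hZ
    rw [← hV, hVe, closure_empty] at h
    exact (hZ.1.nonempty.ne_empty h.symm)
  exact ⟨V, hVo, hVne, hVZ⟩

/-- **Noetherian induction on a dichotomy.** Let `α` be a Noetherian topological space, `pt : P → α`
("complex points over scheme points") and `good ⊆ P`, and suppose that every irreducible closed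
`Y ⊆ α` contains a non-empty relatively open part `O ∩ Y` over which EITHER all points are good OR
none is. Then finitely many irreducible closed `Y`, each good over a non-empty relatively open part,
carry all good points. Proof: Noetherian induction on closed `C ⊆ α` covering the good points over
`C` — take an irreducible component `K` of `C`, the open part `O` given by the dichotomy for `K`,
shrink it to avoid the other components, and recurse on `C` minus that open part. (The combinatorial
skeleton of "for each component of the Hilbert scheme, either … or …", Charles–Schnell, proof of
Prop. 11.3.11.) [folklore] -/
theorem exists_finite_isIrreducible_cover_of_dichotomy {α : Type u} [TopologicalSpace α]
    [NoetherianSpace α] {P : Type v} (pt : P → α) (good : Set P)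
    (hdich : ∀ Y : Set α, IsClosed Y → IsIrreducible Y →
      ∃ O : Set α, IsOpen O ∧ (O ∩ Y).Nonempty ∧
        ((∀ y, pt y ∈ O ∩ Y → y ∈ good) ∨ (∀ y, pt y ∈ O ∩ Y → y ∉ good))) :
    ∃ F : Set (Set α), F.Finite ∧
      (∀ Y ∈ F, IsClosed Y ∧ IsIrreducible Y ∧
        ∃ O : Set α, IsOpen O ∧ (O ∩ Y).Nonempty ∧ ∀ y, pt y ∈ O ∩ Y → y ∈ good) ∧
      ∀ y ∈ good, ∃ Y ∈ F, pt y ∈ Y := by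
  -- Noetherian induction on closed subsets `C`, covering the good points over `C`
  suffices hC : ∀ C : Closeds α, ∃ F : Set (Set α), F.Finite ∧
      (∀ Y ∈ F, IsClosed Y ∧ IsIrreducible Y ∧
        ∃ O : Set α, IsOpen O ∧ (O ∩ Y).Nonempty ∧ ∀ y, pt y ∈ O ∩ Y → y ∈ good) ∧
      ∀ y ∈ good, pt y ∈ (C : Set α) → ∃ Y ∈ F, pt y ∈ Y by
    obtain ⟨F, hF, hFgood, hcov⟩ := hC ⊤
    exact ⟨F, hF, hFgood, fun y hy => hcov y hy (Set.mem_univ _)⟩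
  intro C
  induction C using WellFoundedLT.induction with
  | ind C ih =>
    rcases (C : Set α).eq_empty_or_nonempty with h0 | ⟨q, hq⟩
    · refine ⟨∅, Set.finite_empty, fun Y hY => (Set.notMem_empty Y hY).elim, fun y _ hy => ?_⟩
      rw [h0] at hy
      exact (Set.notMem_empty _ hy).elim
    -- an irreducible component `K` of the Noetherian subspace `C`, and `Y` its image in `α`
    have hCc : IsClosed (C : Set α) := C.isClosed
    let K : Set ↥(C : Set α) := irreducibleComponent ⟨q, hq⟩
    have hK : K ∈ irreducibleComponents ↥(C : Set α) :=
      irreducibleComponent_mem_irreducibleComponents _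
    obtain ⟨V, hVo, ⟨k₂, hk₂⟩, hVK⟩ := exists_isOpen_nonempty_subset_of_mem_irreducibleComponents hK
    have hYirr : IsIrreducible (Subtype.val '' K) :=
      isIrreducible_irreducibleComponent.image _ continuous_subtype_val.continuousOn
    have hYc : IsClosed (Subtype.val '' K) :=
      hCc.isClosedEmbedding_subtypeVal.isClosedMap _ isClosed_irreducibleComponent
    -- the dichotomy on `Y`, shrunk to avoid the other components
    obtain ⟨O, hOo, ⟨a, haO, ⟨k₁, hk₁K, rfl⟩⟩, hO⟩ := hdich _ hYc hYirr
    set W : Set ↥(C : Set α) := Subtype.val ⁻¹' O ∩ V with hWdef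
    have hWo : IsOpen W := (hOo.preimage continuous_subtype_val).inter hVo
    have hWne : (K ∩ W).Nonempty :=
      isIrreducible_irreducibleComponent.isPreirreducible _ V (hOo.preimage continuous_subtype_val)
        hVo ⟨k₁, hk₁K, haO⟩ ⟨k₂, hVK hk₂, hk₂⟩
    have hWK : W ⊆ K := fun w hw => hVK hw.2
    -- the smaller closed set `C' = C ∖ W`
    have hC'c : IsClosed (Subtype.val '' Wᶜ) :=
      hCc.isClosedEmbedding_subtypeVal.isClosedMap _ hWo.isClosed_compl
    let C' : Closeds α := ⟨Subtype.val '' Wᶜ, hC'c⟩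
    have hC'le : C' ≤ C := by
      intro x hx
      obtain ⟨w, -, rfl⟩ := hx
      exact w.2
    have hC'lt : C' < C := by
      refine lt_of_le_of_ne hC'le fun he => ?_
      obtain ⟨w, -, hwW⟩ := hWne
      have hw : (w : α) ∈ (C' : Set α) := by
        rw [he]
        exact w.2
      obtain ⟨w', hw', hww'⟩ := hw
      exact hw' (Subtype.val_injective hww' ▸ hwW)
    obtain ⟨F', hF', hF'good, hcov'⟩ := ih C' hC'lt
    -- points of `C` off `C'` lie in `W ⊆ K ∩ O`
    have hsplit : ∀ x ∈ (C : Set α), x ∉ (C' : Set α) → ∃ w ∈ W, (w : α) = x := by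
      intro x hx hx'
      refine ⟨⟨x, hx⟩, ?_, rfl⟩
      by_contra hw
      exact hx' ⟨⟨x, hx⟩, hw, rfl⟩
    rcases hO with hgoodO | hbadO
    · refine ⟨insert (Subtype.val '' K) F', hF'.insert _, ?_, ?_⟩
      · rintro Y (rfl | hY)
        · exact ⟨hYc, hYirr, O, hOo, ⟨(k₁ : α), haO, k₁, hk₁K, rfl⟩, hgoodO⟩
        · exact hF'good Y hY
      · intro y hy hyC
        by_cases hyC' : pt y ∈ (C' : Set α)
        · obtain ⟨Y, hY, hyY⟩ := hcov' y hy hyC'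
          exact ⟨Y, Set.mem_insert_of_mem _ hY, hyY⟩
        · obtain ⟨w, hwW, hwy⟩ := hsplit _ hyC hyC'
          exact ⟨Subtype.val '' K, Set.mem_insert _ _, w, hWK hwW, hwy⟩
    · refine ⟨F', hF', hF'good, fun y hy hyC => ?_⟩
      by_cases hyC' : pt y ∈ (C' : Set α)
      · exact hcov' y hy hyC'
      · obtain ⟨w, hwW, hwy⟩ := hsplit _ hyC hyC'
        exact (hbadO y ⟨hwy ▸ hwW.1, w, hWK hwW, hwy⟩ hy).elim

/-! ### The algebraicity locus from a complete family of parameter spaces with the dichotomy -/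

variable {𝒳 S : Motives.SchemeOver ℂ} (f : 𝒳 ⟶ S)

/-- **Assembly of the structure theorem on the algebraicity locus from published inputs and the
generic dichotomy.** Let `f : 𝒳 ⟶ S` be a smooth projective family of relative dimension `n` over
a smooth quasi-projective base and `A ∈ H²ᵖ(𝒳(ℂ); ℂ)`. Suppose given countably many PROPER
parameter `S`-schemes `h_i : H_i ⟶ S` with Zariski-closed families of supports `𝒵_i ⊆ 𝒳 × H_i`
and sets `Good_i ⊆ H_i(ℂ)` of complex points such that
* (`hGood`) a good `y` has a slice `(𝒵_i)_y ⊆ 𝒳_{h_i(y)}` of codimension `≥ p` off which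
  `A|_{𝒳_{h_i(y)}}` dies;
* (`hcomplete`, completeness of the witnesses) whenever `A|_{𝒳_t}` is algebraic, `t = h_i(y)` for
  some good `y`;
* (`hdich`, the generic dichotomy) every irreducible closed `Y ⊆ H_i` has a non-empty relatively
  open part over which either all complex points are good or none is;
then, GRANTED Mumford's lemma on curves through two points (`hM`, the tree's named fact
`Motives.mumford_smoothCurve_through_two_points`), the algebraicity locus
`{t ∈ S(ℂ) | A|_{𝒳_t} ∈ algebraicClasses (𝒳_t) p}` is `⋃_j W_j(ℂ)` for countably many Zariski-closed
`W_j ⊆ S`. Proof: Noetherian induction (`exists_finite_isIrreducible_cover_of_dichotomy`) covers the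
good points of each `H_i` by finitely many irreducible closed `Y` good over dense open parts; by the
boundary step (`mem_algebraicClasses_of_mem_irreducible`) ALL complex points over such `Y` give
algebraic classes; the images `h_i(Y)` are closed (`h_i` proper) and exhaust the locus
(`exists_isClosed_eq_iUnion_of_parametrisation`). This is the architecture of the printed proof
with "component of the relative Hilbert scheme whose cycle class is `α_t`" replaced by "irreducible
closed set of parameters of supports off which `A` dies".
[cite: CharlesSchnell2014Notes, Prop. 11.3.11 (proof)]
[cite: VoisinHodgeII2003, §3.3.1 and §7.3.2 (proof of Thm. 7.19)] -/
theorem algebraicityLocus_eq_iUnion_of_dichotomy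
    (hM : Motives.mumford_smoothCurve_through_two_points) {n : ℕ}
    (hfam : Motives.IsSmoothProjectiveFamily f n) (hS : IsQuasiProjectiveOver S)
    (hSsm : Smooth S.hom) (p : ℕ) (A : complexBetti 𝒳 (2 * p)) {ι : Type} [Countable ι]
    (H : ι → Motives.SchemeOver ℂ) (h : ∀ i, H i ⟶ S) [∀ i, IsProper (h i).left]
    (𝒵 : ∀ i, Set (𝒳 ⊗ H i).left) (h𝒵 : ∀ i, IsClosed (𝒵 i))
    (Good : ∀ i, Set (Motives.ComplexPoints (H i)))
    (hGood : ∀ i (y : Motives.ComplexPoints (H i)), y ∈ Good i →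
      (∀ x : 𝒳.left, (sliceAt 𝒳 y).left.base x ∈ 𝒵 i → height x + p ≤ (n : ℕ∞)) ∧
      complexBetti.map (Motives.fiberι f (AlgPoints.map (h i) y)) (2 * p) A ∈
        LinearMap.ker (complexBetti.restrictCompl (Motives.fiberOver f (AlgPoints.map (h i) y))
          ((lift (Motives.fiberι f (AlgPoints.map (h i) y))
            (Motives.fiberOverToSpec f (AlgPoints.map (h i) y) ≫ y)).left.base ⁻¹' 𝒵 i)
              (2 * p)).hom)
    (hcomplete : ∀ t : Motives.ComplexPoints S,
      complexBetti.map (Motives.fiberι f t) (2 * p) A ∈ algebraicClasses (Motives.fiberOver f t) p →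
        ∃ i, ∃ y ∈ Good i, y ≫ h i = t)
    (hdich : ∀ i (Y : Set (H i).left), IsClosed Y → IsIrreducible Y →
      ∃ O : Set (H i).left, IsOpen O ∧ (O ∩ Y).Nonempty ∧
        ((∀ y : Motives.ComplexPoints (H i), y.pt ∈ O ∩ Y → y ∈ Good i) ∨
          (∀ y : Motives.ComplexPoints (H i), y.pt ∈ O ∩ Y → y ∉ Good i))) :
    ∃ W : ℕ → Set S.left, (∀ j, IsClosed (W j)) ∧
      {t : Motives.ComplexPoints S |
          complexBetti.map (Motives.fiberι f t) (2 * p) A ∈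
            algebraicClasses (Motives.fiberOver f t) p} = ⋃ j, {t | t.pt ∈ W j} := by
  haveI : Smooth S.hom := hSsm
  haveI : ∀ i, NoetherianSpace (H i).left := fun i =>
    noetherianSpace_of_isProper_of_isQuasiProjectiveOver (h i) hS
  haveI : ∀ i, LocallyOfFiniteType (H i).hom := fun i => by
    rw [← Over.w (h i)]
    infer_instance
  -- finitely many good irreducible closed sets per parameter space
  have hfc : ∀ i, ∃ F : Set (Set (H i).left), F.Finite ∧
      (∀ Y ∈ F, IsClosed Y ∧ IsIrreducible Y ∧ ∃ O : Set (H i).left, IsOpen O ∧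
        (O ∩ Y).Nonempty ∧ ∀ y : Motives.ComplexPoints (H i), y.pt ∈ O ∩ Y → y ∈ Good i) ∧
      ∀ y ∈ Good i, ∃ Y ∈ F, y.pt ∈ Y := fun i =>
    exists_finite_isIrreducible_cover_of_dichotomy (fun y : Motives.ComplexPoints (H i) => y.pt)
      (Good i) (hdich i)
  choose F hF hFgood hcov using hfc
  refine exists_isClosed_eq_iUnion_of_parametrisation _ H h (fun i => ⋃ Y ∈ F i, Y)
    (fun i => (hF i).isClosed_biUnion fun Y hY => (hFgood i Y hY).1) fun t => ⟨fun ht => ?_, ?_⟩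
  · obtain ⟨i, y, hy, hyt⟩ := hcomplete t ht
    obtain ⟨Y, hY, hyY⟩ := hcov i y hy
    exact ⟨i, y, Set.mem_biUnion hY hyY, hyt⟩
  · rintro ⟨i, y, hy, hyt⟩
    obtain ⟨Y, hY, hyY⟩ := Set.mem_iUnion₂.1 hy
    obtain ⟨hYc, hYirr, O, hOo, hOY, hOgood⟩ := hFgood i Y hY
    subst hyt
    exact mem_algebraicClasses_of_mem_irreducible f hM hfam hS hSsm (h i) (h𝒵 i) p A hYc hYirr
      hOo hOY (fun y' hy' => (hGood i y' (hOgood y' hy')).1)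
      (fun y' hy' => (hGood i y' (hOgood y' hy')).2) y hyY

end HodgeTheory

end Literature.AlgebraicGeometry.HodgeTheory

end
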